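import Literature.NumberTheory.LFunctions.LargeValuesEnergyBound
import HarnessLib

/-!
# Guth–Maynard Proposition 11.1 (bound for energy) as printed, with `T` free — NOT RH-BEARING: a density / large-values theorem counts zeros off the line, it never empties the strip (Barrier LindelofBacklund)

NOT RH-BEARING (D-0040): a large-values / zero-density statement COUNTS large values of a Dirichlet
polynomial or zeros off the critical line, it never empties the strip
(`Literature.Barriers.RiemannHypothesis.LindelofBacklund`); nothing in this file bears on the truth of
the Riemann Hypothesis, and nothing here is progress toward it. Cell rh-crit, corpus C4
(Guth–Maynard), work package WP-B1b; bears_on LADDER-RH §4 HELD row `DensityLadder`.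

Topic `NumberTheory/LFunctions`, family RH. Source: L. Guth, J. Maynard, *New large value estimates
for Dirichlet polynomials*, Ann. of Math. (2) 203 (2026), 623–675 = arXiv:2405.20552, §11. The tree's
`GuthMaynardEnergyBound.energy_bound` (`LargeValuesEnergyBound.lean`) proves **Proposition 11.1**
in the regime of Proposition 3.1 (`T = N^{6/5}`, `σ ∈ [7/10, 4/5]`), which is all the proof of
Theorem 1.2 needs. The printed proposition has `T` free:

> **Proposition 11.1 (Bound for energy).** Suppose that `D(t) = ∑_{n∼N} b_n n^{it}` with `|b_n| ≤ 1`.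
> Suppose that `W` is a `1`-separated set contained in an interval of length `T`, and that
> `|D(t)| ≥ N^σ` for `t ∈ W`. If `T^{3/4} ≤ N ≤ T`, then
> `E(W) ⪅ |W|N^{4−4σ} + |W|^{21/8}T^{1/4}N^{1−2σ} + |W|³N^{1−2σ}`.

This file states it as printed (`GuthMaynard2026_proposition_11_1`, with `⪅` rendered per §1.2 of
the paper as `∀ ε > 0 ∃ C T₀ ∀ T ≥ T₀: … ≤ C T^ε (…)`, `n ∼ N` as `N < n ≤ 2N`, `σ` unrestricted) and
PROVES it (`GuthMaynard2026_proposition_11_1_holds`) by re-running the printed §11 assembly with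
`T` free, from the `T`-uniform lemmas already proved in the tree:

* Lemma 11.4 (`GuthMaynardEnergy.energy_le_third_moment_abs`): `E(W) ≤ C₀N^{-2σ}∑|R(n₁/n₂)|³`;
* Lemma 11.8 (`GuthMaynardSmallGCD.small_gcd_third_moment`, general `T, D, Dl`), used with
  `D = ⌈N²/T⌉`, `Dl = T^η` (eq. (11.23): `∑_{gcd ≤ D}|R|³ ⪅ N²|W|^{1/2}E(W)^{1/2}`): `small_part`;
* Lemma 11.9 before its case analysis (`GuthMaynardEnergyBound.large_gcd_third_moment`, general
  `T, D`) and the printed case analysis `|W| ≷ T^{2/3}` (eqs. (11.25)–(11.27)) as an inequality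
  between real numbers for `T^{3/4} ≤ N ≤ T` (`large_gcd_algebra`): `large_part`;
* the rearrangement `E ≤ X + YE^{1/2} ⇒ E ≤ 2X + Y²` (`GuthMaynardEnergyBound.le_of_sqrt_bound`):
  `final_algebra`.

It is one of the three `T`-free inputs (with Propositions 6.1 and 10.1) of eq. (12.1) of the paper
read with `T` free, which the proof of Proposition 12.1 uses for `T^{5/6} ≤ N ≤ T`. No definition
other than the as-printed statement, no named fact left unproved, no conjecture.

## References

* L. Guth, J. Maynard, *New large value estimates for Dirichlet polynomials*, Ann. of Math. (2) 203
  (2026), no. 2, 623–675; arXiv:2405.20552: §11, Proposition 11.1 (arXiv v2 p. 38), Lemmas 11.4,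
  11.8, 11.9, eqs. (11.22)–(11.27), proof of Proposition 11.1 (arXiv v2 p. 45). [key
  `GuthMaynard2026`; corpus-tex chunks p0022:L21–L26, p0024:L22–p0025:L31]
* D. R. Heath-Brown, *A large values estimate for Dirichlet polynomials*, J. London Math. Soc. (2) 20
  (1979), 8–18 (via `DiscreteMomentsR.lean`).
-/

noncomputable section

open Real Complex Finset

namespace Literature.NumberTheory.LFunctions

open GuthMaynardRFunction GuthMaynardEnergy GuthMaynardDiscreteMoments GuthMaynardSmallGCD
  GuthMaynardAssembly GuthMaynardEnergyBound

/-! ## §1. Proposition 11.1 as printed -/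

/-- **Guth–Maynard Proposition 11.1 (Bound for energy), as printed.** Suppose that
`D(t) = ∑_{N<n≤2N} b_n n^{it}` with `|b_n| ≤ 1`, that `W` is a `1`-separated set contained in an
interval of length `T`, and that `|D(t)| ≥ N^σ` for `t ∈ W`. If `T^{3/4} ≤ N ≤ T`, then
`E(W) ⪅ |W|N^{4−4σ} + |W|^{21/8}T^{1/4}N^{1−2σ} + |W|³N^{1−2σ}`, where
`E(W) = #{(t₁,t₂,t₃,t₄) ∈ W⁴ : |t₁+t₂−t₃−t₄| ≤ 1}` is `GuthMaynardAssembly.addEnergy W` and `⪅`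
(§1.2 of the paper: `≤ C(ε)T^ε ·` for every `ε > 0` and all large `T`) is rendered as
`∀ ε > 0, ∃ C T₀, ∀ T ≥ T₀, … ≤ C T^ε (…)`, the constant uniform in `N, σ, b, W` and the position
`t₀` of the interval. (`σ` is unrestricted, as printed; the tree's `GuthMaynardEnergyBound.energy_bound`
is the case `T = N^{6/5}`.) PROVED below: `GuthMaynard2026_proposition_11_1_holds`.
[cite: GuthMaynard2026, Proposition 11.1 (arXiv v2 p. 38)] -/
def GuthMaynard2026_proposition_11_1 : Prop :=
  ∀ ε : ℝ, 0 < ε → ∃ C T₀ : ℝ, ∀ T : ℝ, T₀ ≤ T → ∀ N : ℕ, T ^ (3 / 4 : ℝ) ≤ (N : ℝ) → (N : ℝ) ≤ T →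
    ∀ (σ : ℝ) (b : ℕ → ℂ) (t₀ : ℝ) (W : Finset ℝ), (∀ n, ‖b n‖ ≤ 1) →
    (∀ t ∈ W, t₀ ≤ t ∧ t ≤ t₀ + T) → (∀ t ∈ W, ∀ t' ∈ W, t ≠ t' → 1 ≤ |t - t'|) →
    (∀ t ∈ W, (N : ℝ) ^ σ ≤ ‖∑ n ∈ Finset.Ioc N (2 * N), b n * (n : ℂ) ^ ((t : ℂ) * I)‖) →
    GuthMaynardAssembly.addEnergy W ≤ C * T ^ ε * ((W.card : ℝ) * (N : ℝ) ^ (4 - 4 * σ) +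
      (W.card : ℝ) ^ (21 / 8 : ℝ) * T ^ (1 / 4 : ℝ) * (N : ℝ) ^ (1 - 2 * σ) +
      (W.card : ℝ) ^ 3 * (N : ℝ) ^ (1 - 2 * σ))

namespace GuthMaynardEnergyAsPrinted

/-! ## §2. The case analysis of Lemma 11.9 with `T` free -/

set_option maxHeartbeats 1600000 in
/-- **The case analysis of Lemma 11.9 as an inequality between reals, `T` free** (eqs.
(11.25)–(11.27) of the paper): if `T ≥ 1`, `T^{3/4} ≤ N`, `K ≥ 1` and `K² ≤ E ≤ 3K³` then, with
`A₀ = K²N + KT + K^{5/4}T^{1/2}N` and `B₀ = K⁴N + TE + E^{3/4}KT^{1/2}N`,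
`A₀^{1/2} B₀^{1/2} ≤ 5K³N + 2K^{21/8}T^{1/4}N + 4E^{1/2}K^{1/2}N²`. As printed: `KT ≤ K^{5/4}T^{1/2}N`
(as `N ≥ T^{1/2}`); case `|W| > T^{2/3}`: `A₀ ≤ 3K²N`, `B₀ ≤ 7K⁴N`; case `|W| ≤ T^{2/3}`:
`A₀ ≤ 3K^{5/4}T^{1/2}N` and the three products are `≤ u², v², v²` with `u = K^{21/8}T^{1/4}N`,
`v = E^{1/2}K^{1/2}N²` (the last because `T^{1/2}|W|^{5/8} ≤ E(W)^{1/8}N`).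
[cite: GuthMaynard2026, proof of Lemma 11.9 (arXiv v2 pp. 44–45)] -/
theorem large_gcd_algebra {N T K E : ℝ} (hT : 1 ≤ T) (hNT : T ^ (3 / 4 : ℝ) ≤ N)
    (hK : 1 ≤ K) (hEK : K ^ 2 ≤ E) (hE3 : E ≤ 3 * K ^ 3) :
    (K ^ 2 * N + K * T + K ^ (5 / 4 : ℝ) * T ^ (1 / 2 : ℝ) * N) ^ (1 / 2 : ℝ) *
      (K ^ 4 * N + T * E + E ^ (3 / 4 : ℝ) * K * T ^ (1 / 2 : ℝ) * N) ^ (1 / 2 : ℝ) ≤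
      5 * K ^ 3 * N + 2 * K ^ (21 / 8 : ℝ) * T ^ (1 / 4 : ℝ) * N +
        4 * E ^ (1 / 2 : ℝ) * K ^ (1 / 2 : ℝ) * N ^ 2 := by
  have hT0 : 0 < T := by linarith
  have hT34 : 1 ≤ T ^ (3 / 4 : ℝ) := Real.one_le_rpow hT (by norm_num)
  have hN : 1 ≤ N := hT34.trans hNT
  have hN0 : 0 < N := by linarith
  have hK0 : 0 < K := by linarith
  have hE0 : 0 < E := by nlinarith
  have hN1 : ∀ {a b : ℝ}, a ≤ b → N ^ a ≤ N ^ b := fun h ↦ Real.rpow_le_rpow_of_exponent_le hN h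
  have hK1 : ∀ {a b : ℝ}, a ≤ b → K ^ a ≤ K ^ b := fun h ↦ Real.rpow_le_rpow_of_exponent_le hK h
  have hT1 : ∀ {a b : ℝ}, a ≤ b → T ^ a ≤ T ^ b := fun h ↦ Real.rpow_le_rpow_of_exponent_le hT h
  -- the square root of `T` and its powers
  set S : ℝ := T ^ (1 / 2 : ℝ) with hS
  have hS1 : 1 ≤ S := Real.one_le_rpow hT (by norm_num)
  have hS0 : 0 < S := by linarith
  have hSS : S * S = T := by
    rw [hS, ← Real.rpow_add hT0]; norm_num
  have hS14 : (T ^ (1 / 4 : ℝ)) ^ 2 = S := by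
    rw [hS, ← Real.rpow_natCast, ← Real.rpow_mul hT0.le]; norm_num
  have hSN : S ≤ N := (hT1 (by norm_num : (1 / 2 : ℝ) ≤ 3 / 4)).trans hNT
  -- `S = (T^{3/4})^{2/3} ≤ N^{2/3}` and `S³ = (T^{3/4})² ≤ N²`
  have hS23 : S ≤ N ^ (2 / 3 : ℝ) := by
    calc S = (T ^ (3 / 4 : ℝ)) ^ (2 / 3 : ℝ) := by rw [hS, ← Real.rpow_mul hT0.le]; norm_num
      _ ≤ N ^ (2 / 3 : ℝ) := Real.rpow_le_rpow (by positivity) hNT (by norm_num)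
  have hS3 : S * T ≤ N ^ 2 := by
    calc S * T = (T ^ (3 / 4 : ℝ)) ^ 2 := by
          rw [hS, ← Real.rpow_natCast, ← Real.rpow_mul hT0.le, ← Real.rpow_add_one hT0.ne']
          norm_num
      _ ≤ N ^ 2 := pow_le_pow_left₀ (by positivity) hNT 2
  set A₀ : ℝ := K ^ 2 * N + K * T + K ^ (5 / 4 : ℝ) * S * N with hA₀
  set B₀ : ℝ := K ^ 4 * N + T * E + E ^ (3 / 4 : ℝ) * K * S * N with hB₀
  set u : ℝ := K ^ (21 / 8 : ℝ) * T ^ (1 / 4 : ℝ) * N with hu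
  set v : ℝ := E ^ (1 / 2 : ℝ) * K ^ (1 / 2 : ℝ) * N ^ 2 with hv
  set Z : ℝ := 5 * K ^ 3 * N + 2 * u + 4 * v with hZ
  have hA₀0 : 0 ≤ A₀ := by positivity
  have hB₀0 : 0 ≤ B₀ := by positivity
  have hu0 : 0 ≤ u := by positivity
  have hv0 : 0 ≤ v := by positivity
  have hZ0 : 0 ≤ Z := by positivity
  -- some power identities
  have eK2 : K ^ (5 / 4 : ℝ) * K ^ (3 / 4 : ℝ) = K ^ 2 := by
    rw [← Real.rpow_add hK0]; norm_num
  have eK54 : K ^ (5 / 4 : ℝ) = K ^ (1 / 4 : ℝ) * K := by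
    rw [show K ^ (1 / 4 : ℝ) * K = K ^ (1 / 4 : ℝ) * K ^ (1 : ℝ) by rw [Real.rpow_one],
      ← Real.rpow_add hK0]; norm_num
  have hKle54 : K ≤ K ^ (5 / 4 : ℝ) := by
    calc K = K ^ (1 : ℝ) := (Real.rpow_one K).symm
      _ ≤ K ^ (5 / 4 : ℝ) := hK1 (by norm_num)
  have eE34 : E ^ (3 / 4 : ℝ) ≤ 3 * K ^ (9 / 4 : ℝ) := by
    calc E ^ (3 / 4 : ℝ) ≤ (3 * K ^ 3) ^ (3 / 4 : ℝ) := Real.rpow_le_rpow hE0.le hE3 (by norm_num)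
      _ = (3 : ℝ) ^ (3 / 4 : ℝ) * K ^ (9 / 4 : ℝ) := by
          rw [Real.mul_rpow (by norm_num) (by positivity), show (K ^ 3) ^ (3 / 4 : ℝ) = K ^ (9 / 4 : ℝ) by
            rw [show K ^ 3 = K ^ (3 : ℝ) by norm_cast, ← Real.rpow_mul hK0.le]; norm_num]
      _ ≤ 3 * K ^ (9 / 4 : ℝ) := by
          gcongr
          calc (3 : ℝ) ^ (3 / 4 : ℝ) ≤ (3 : ℝ) ^ (1 : ℝ) :=
                Real.rpow_le_rpow_of_exponent_le (by norm_num) (by norm_num)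
            _ = 3 := Real.rpow_one 3
  -- the middle term of `A₀`: `K T ≤ K^{5/4} S N` (as `S ≤ N`)
  have hA2 : K * T ≤ K ^ (5 / 4 : ℝ) * S * N := by
    calc K * T = K * S * S := by rw [mul_assoc, hSS]
      _ ≤ K ^ (5 / 4 : ℝ) * S * N := by gcongr
  -- main claim: `A₀ B₀ ≤ Z²`
  have hmain : A₀ * B₀ ≤ Z ^ 2 := by
    rcases le_or_gt S (K ^ (3 / 4 : ℝ)) with hcase | hcase
    · -- Case 1: `T^{1/2} ≤ K^{3/4}` (i.e. `|W| ≥ T^{2/3}`)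
      have hA3 : K ^ (5 / 4 : ℝ) * S * N ≤ K ^ 2 * N := by
        rw [← eK2]
        exact mul_le_mul_of_nonneg_right (mul_le_mul_of_nonneg_left hcase (by positivity)) hN0.le
      have hA : A₀ ≤ 3 * (K ^ 2 * N) := by rw [hA₀]; linarith
      -- `T = S·S ≤ K^{3/4} N^{2/3} ≤ K N`
      have hTKN : T ≤ K * N := by
        have h1 : K ^ (3 / 4 : ℝ) ≤ K := by
          calc K ^ (3 / 4 : ℝ) ≤ K ^ (1 : ℝ) := hK1 (by norm_num)
            _ = K := Real.rpow_one K
        have h2 : N ^ (2 / 3 : ℝ) ≤ N := by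
          calc N ^ (2 / 3 : ℝ) ≤ N ^ (1 : ℝ) := hN1 (by norm_num)
            _ = N := Real.rpow_one N
        calc T = S * S := hSS.symm
          _ ≤ K ^ (3 / 4 : ℝ) * N ^ (2 / 3 : ℝ) := mul_le_mul hcase hS23 hS0.le (by positivity)
          _ ≤ K * N := mul_le_mul h1 h2 (by positivity) hK0.le
      have hB2 : T * E ≤ 3 * (K ^ 4 * N) := by
        calc T * E ≤ (K * N) * (3 * K ^ 3) := mul_le_mul hTKN hE3 hE0.le (by positivity)
          _ = 3 * (K ^ 4 * N) := by ring
      have hB3 : E ^ (3 / 4 : ℝ) * K * S * N ≤ 3 * (K ^ 4 * N) := by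
        have e1 : K ^ (9 / 4 : ℝ) * K * K ^ (3 / 4 : ℝ) = K ^ 4 := by
          rw [show K ^ (9 / 4 : ℝ) * K = K ^ (9 / 4 : ℝ) * K ^ (1 : ℝ) by rw [Real.rpow_one],
            ← Real.rpow_add hK0, ← Real.rpow_add hK0]; norm_num
        calc E ^ (3 / 4 : ℝ) * K * S * N ≤ (3 * K ^ (9 / 4 : ℝ)) * K * K ^ (3 / 4 : ℝ) * N := by
              gcongr
          _ = 3 * (K ^ 4 * N) := by rw [← e1]; ring
      have hB : B₀ ≤ 7 * (K ^ 4 * N) := by rw [hB₀]; linarith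
      calc A₀ * B₀ ≤ (3 * (K ^ 2 * N)) * (7 * (K ^ 4 * N)) := mul_le_mul hA hB hB₀0 (by positivity)
        _ = 21 * (K ^ 3 * N) ^ 2 := by ring
        _ ≤ (5 * K ^ 3 * N) ^ 2 := by nlinarith [sq_nonneg (K ^ 3 * N)]
        _ ≤ Z ^ 2 := by
            refine pow_le_pow_left₀ (by positivity) ?_ 2
            rw [hZ]; linarith
    · -- Case 2: `K^{3/4} ≤ T^{1/2}` (i.e. `|W| ≤ T^{2/3}`)
      have hc := hcase.le
      have hA1 : K ^ 2 * N ≤ K ^ (5 / 4 : ℝ) * S * N := by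
        rw [← eK2]
        exact mul_le_mul_of_nonneg_right (mul_le_mul_of_nonneg_left hc (by positivity)) hN0.le
      have hA : A₀ ≤ 3 * (K ^ (5 / 4 : ℝ) * S * N) := by rw [hA₀]; linarith
      -- the three products
      have hP1 : K ^ (5 / 4 : ℝ) * S * N * (K ^ 4 * N) = u ^ 2 := by
        rw [hu, mul_pow, mul_pow, hS14, ← Real.rpow_natCast (K ^ (21 / 8 : ℝ)) 2, ← Real.rpow_mul hK0.le]
        have e1 : K ^ (5 / 4 : ℝ) * K ^ 4 = K ^ ((21 / 8 : ℝ) * (2 : ℕ)) := by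
          rw [show K ^ 4 = K ^ (4 : ℝ) by norm_cast, ← Real.rpow_add hK0]; norm_num
        rw [← e1]; ring
      have hv2 : v ^ 2 = E * K * N ^ 4 := by
        have e1 : (E ^ (1 / 2 : ℝ)) ^ 2 = E := by
          rw [← Real.rpow_natCast, ← Real.rpow_mul hE0.le]; norm_num
        have e2 : (K ^ (1 / 2 : ℝ)) ^ 2 = K := by
          rw [← Real.rpow_natCast, ← Real.rpow_mul hK0.le]; norm_num
        rw [hv, mul_pow, mul_pow, e1, e2]; ring
      -- `K^{1/4} S³ ≤ N³`: `K^{1/4} ≤ S^{1/3} ≤ N^{1/3}`... done as `K^{1/4} S T ≤ N · N²`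
      have hK14S : K ^ (1 / 4 : ℝ) ≤ N := by
        calc K ^ (1 / 4 : ℝ) ≤ K ^ (3 / 4 : ℝ) := hK1 (by norm_num)
          _ ≤ S := hc
          _ ≤ N := hSN
      have hP2 : K ^ (5 / 4 : ℝ) * S * N * (T * E) ≤ v ^ 2 := by
        rw [hv2, eK54]
        calc K ^ (1 / 4 : ℝ) * K * S * N * (T * E) = K ^ (1 / 4 : ℝ) * (S * T) * (K * E * N) := by ring
          _ ≤ N * N ^ 2 * (K * E * N) := by gcongr
          _ = E * K * N ^ 4 := by ring
      have hE14 : K ^ (1 / 2 : ℝ) ≤ E ^ (1 / 4 : ℝ) := by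
        calc K ^ (1 / 2 : ℝ) = (K ^ 2) ^ (1 / 4 : ℝ) := by
              rw [show K ^ 2 = K ^ (2 : ℝ) by norm_cast, ← Real.rpow_mul hK0.le]; norm_num
          _ ≤ E ^ (1 / 4 : ℝ) := Real.rpow_le_rpow (by positivity) hEK (by norm_num)
      have hP3 : K ^ (5 / 4 : ℝ) * S * N * (E ^ (3 / 4 : ℝ) * K * S * N) ≤ v ^ 2 := by
        rw [hv2]
        -- `K^{5/4}·K = K^{1/2}·K^{3/4}·K ≤ E^{1/4}·S·K`, `E^{3/4}E^{1/4} = E`, `S·S·S·N·N ≤ N⁴`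
        have e1 : K ^ (5 / 4 : ℝ) * K = K ^ (1 / 2 : ℝ) * K ^ (3 / 4 : ℝ) * K := by
          rw [← Real.rpow_add hK0]; norm_num
        have e2 : E ^ (3 / 4 : ℝ) * E ^ (1 / 4 : ℝ) = E := by
          rw [← Real.rpow_add hE0]; norm_num
        have e3 : S * S * S * N * N ≤ N ^ 4 := by
          calc S * S * S * N * N = (S * T) * N * N := by rw [← hSS]; ring
            _ ≤ N ^ 2 * N * N := by gcongr
            _ = N ^ 4 := by ring
        calc K ^ (5 / 4 : ℝ) * S * N * (E ^ (3 / 4 : ℝ) * K * S * N)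
            = (K ^ (5 / 4 : ℝ) * K) * E ^ (3 / 4 : ℝ) * (S * S * N * N) := by ring
          _ = (K ^ (1 / 2 : ℝ) * K ^ (3 / 4 : ℝ) * K) * E ^ (3 / 4 : ℝ) * (S * S * N * N) := by rw [e1]
          _ ≤ (E ^ (1 / 4 : ℝ) * S * K) * E ^ (3 / 4 : ℝ) * (S * S * N * N) := by gcongr
          _ = (E ^ (3 / 4 : ℝ) * E ^ (1 / 4 : ℝ)) * K * (S * S * S * N * N) := by ring
          _ ≤ (E ^ (3 / 4 : ℝ) * E ^ (1 / 4 : ℝ)) * K * N ^ 4 := by gcongr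
          _ = E * K * N ^ 4 := by rw [e2]
      have hAB : A₀ * B₀ ≤ 3 * u ^ 2 + 6 * v ^ 2 := by
        calc A₀ * B₀ ≤ 3 * (K ^ (5 / 4 : ℝ) * S * N) * B₀ := mul_le_mul_of_nonneg_right hA hB₀0
          _ = 3 * (K ^ (5 / 4 : ℝ) * S * N * (K ^ 4 * N)) +
              3 * (K ^ (5 / 4 : ℝ) * S * N * (T * E)) +
              3 * (K ^ (5 / 4 : ℝ) * S * N * (E ^ (3 / 4 : ℝ) * K * S * N)) := by
              rw [hB₀]; ring
          _ ≤ 3 * u ^ 2 + 3 * v ^ 2 + 3 * v ^ 2 := by rw [hP1]; linarith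
          _ = 3 * u ^ 2 + 6 * v ^ 2 := by ring
      calc A₀ * B₀ ≤ 3 * u ^ 2 + 6 * v ^ 2 := hAB
        _ ≤ 3 * u ^ 2 + 6 * v ^ 2 + (u ^ 2 + 10 * v ^ 2 + 16 * (u * v)) :=
            le_add_of_nonneg_right (by have := mul_nonneg hu0 hv0; positivity)
        _ = (2 * u + 4 * v) ^ 2 := by ring
        _ ≤ Z ^ 2 := by
            refine pow_le_pow_left₀ (by positivity) ?_ 2
            rw [hZ]
            have : 0 ≤ 5 * K ^ 3 * N := by positivity
            linarith
  -- conclusion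
  calc A₀ ^ (1 / 2 : ℝ) * B₀ ^ (1 / 2 : ℝ) = (A₀ * B₀) ^ (1 / 2 : ℝ) := (Real.mul_rpow hA₀0 hB₀0).symm
    _ ≤ (Z ^ 2) ^ (1 / 2 : ℝ) := Real.rpow_le_rpow (by positivity) hmain (by norm_num)
    _ = Z := by rw [← Real.sqrt_eq_rpow, Real.sqrt_sq hZ0]
    _ = _ := by rw [hZ, hu, hv]; ring

/-! ## §3. The two halves of `∑|R(n₁/n₂)|³` with `T` free -/

set_option maxHeartbeats 1600000 in
/-- **The small-gcd part of `∑|R|³`, `T` free** (Lemma 11.8 of the paper with `D = ⌈N²/T⌉`, eq.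
(11.23)): for `η > 0` there is `C` with
`∑_{d≤D} ∑_{gcd=d} |R(n₁/n₂)|³ ≤ C T^η N²|W|^{1/2}E(W)^{1/2} + C N|W|³` for all `N ≥ 1`, `1 ≤ T`,
`N ≤ T ≤ N²` and finite non-empty `1`-separated `W` in an interval of length `T`
(`GuthMaynardSmallGCD.small_gcd_third_moment` with `Dl = T^η` and `j` so large that
`Dl^{1−j}|W|⁴ ≤ 16 ≤ 16E(W)`; `DT + N² ≤ 3N²`; the term `DN²|W|³/T³ ≤ 2N|W|³`).
[cite: GuthMaynard2026, Lemma 11.8 and (11.23) (arXiv v2 pp. 43–44)] -/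
theorem small_part {η : ℝ} (hη : 0 < η) :
    ∃ C, 0 ≤ C ∧ ∀ (N : ℕ), 1 ≤ N → ∀ (T t₀ : ℝ), 1 ≤ T → (N : ℝ) ≤ T → T ≤ (N : ℝ) ^ 2 →
      ∀ (W : Finset ℝ), (∀ t ∈ W, t₀ ≤ t ∧ t ≤ t₀ + T) →
      (∀ t ∈ W, ∀ t' ∈ W, t ≠ t' → 1 ≤ |t - t'|) → 1 ≤ W.card →
      ∑ d ∈ Finset.Icc 1 ⌈(N : ℝ) ^ 2 / T⌉₊, ∑ p ∈ gcdPairs N d, ‖Rfun W ((p.1 : ℝ) / p.2)‖ ^ 3 ≤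
        C * T ^ η * ((N : ℝ) ^ 2 * (W.card : ℝ) ^ (1 / 2 : ℝ) * ((((W ×ˢ W) ×ˢ (W ×ˢ W)).filter
            (fun q : (ℝ × ℝ) × (ℝ × ℝ) ↦ |q.1.1 + q.1.2 - q.2.1 - q.2.2| ≤ 1)).card : ℝ) ^ (1 / 2 : ℝ)) +
        C * ((N : ℝ) * (W.card : ℝ) ^ 3) := by
  set j : ℕ := ⌈4 / η⌉₊ + 1 with hj
  have hjη : 4 ≤ η * ((j : ℝ) - 1) := by
    have h1 : ((j : ℝ) - 1) = (⌈4 / η⌉₊ : ℝ) := by rw [hj]; push_cast; ring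
    have h2 : 4 / η ≤ (⌈4 / η⌉₊ : ℝ) := Nat.le_ceil _
    rw [h1]
    calc (4 : ℝ) = η * (4 / η) := by field_simp
      _ ≤ η * (⌈4 / η⌉₊ : ℝ) := by gcongr
  obtain ⟨C₁, hC₁0, hC₁⟩ := small_gcd_third_moment j
  refine ⟨15 * C₁, by positivity, fun N hN T t₀ hT hNT hTN2 W hW hsep hWpos ↦ ?_⟩
  have hn1 : (1 : ℝ) ≤ N := by exact_mod_cast hN
  have hn0 : (0 : ℝ) < N := by linarith
  have hT0 : 0 < T := by linarith
  have hTle : ∀ {x y : ℝ}, x ≤ y → T ^ x ≤ T ^ y :=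
    fun h ↦ Real.rpow_le_rpow_of_exponent_le hT h
  have hTp : ∀ x y : ℝ, T ^ x * T ^ y = T ^ (x + y) := fun x y ↦ (Real.rpow_add hT0 x y).symm
  set K : ℝ := (W.card : ℝ) with hK
  have hK0 : 0 ≤ K := Nat.cast_nonneg _
  have hK1 : 1 ≤ K := by rw [hK]; exact_mod_cast hWpos
  set E₁ : ℝ := ((((W ×ˢ W) ×ˢ (W ×ˢ W)).filter
    (fun q : (ℝ × ℝ) × (ℝ × ℝ) ↦ |q.1.1 + q.1.2 - q.2.1 - q.2.2| ≤ 1)).card : ℝ) with hE₁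
  have hE₁0 : 0 ≤ E₁ := Nat.cast_nonneg _
  have hKE : K ^ 2 ≤ E₁ := card_sq_le_energy W
  have hE₁1 : 1 ≤ E₁ := le_trans (by nlinarith) hKE
  have hKT : K ≤ 2 * T := by
    have h := SeparatedSums.card_le_of_sep one_pos hT0.le W hW hsep
    rw [div_one] at h
    rw [hK]; linarith
  -- `D = ⌈N²/T⌉`
  set D : ℕ := ⌈(N : ℝ) ^ 2 / T⌉₊ with hD
  have hq1 : 1 ≤ (N : ℝ) ^ 2 / T := by rw [le_div_iff₀ hT0, one_mul]; exact hTN2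
  have hD1 : 1 ≤ D := Nat.ceil_pos.mpr (by linarith)
  have hDle : (D : ℝ) ≤ (N : ℝ) ^ 2 / T + 1 := by
    have := Nat.ceil_lt_add_one (by positivity : (0 : ℝ) ≤ (N : ℝ) ^ 2 / T)
    rw [← hD] at this
    exact this.le
  have hDle' : (D : ℝ) ≤ 2 * ((N : ℝ) ^ 2 / T) := by linarith
  -- Lemma 11.8
  set Dl : ℝ := T ^ η with hDl
  have hDl1 : 1 ≤ Dl := Real.one_le_rpow hT hη.le
  have h1 : ∑ d ∈ Finset.Icc 1 D, ∑ p ∈ gcdPairs N d, ‖Rfun W ((p.1 : ℝ) / p.2)‖ ^ 3 ≤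
      C₁ * ((D : ℝ) * T + (N : ℝ) ^ 2) * K ^ (1 / 2 : ℝ) * (Dl * E₁ + Dl / Dl ^ j * K ^ 4) ^ (1 / 2 : ℝ) +
        C₁ * D * (N : ℝ) ^ 2 * K ^ 3 / T ^ 3 :=
    hC₁ N D hN hD1 T t₀ Dl hT hDl1 W hW hsep
  have hDT : (D : ℝ) * T + (N : ℝ) ^ 2 ≤ 3 * (N : ℝ) ^ 2 := by
    have e1 : ((N : ℝ) ^ 2 / T + 1) * T = (N : ℝ) ^ 2 + T := by field_simp
    have : (D : ℝ) * T ≤ ((N : ℝ) ^ 2 / T + 1) * T := mul_le_mul_of_nonneg_right hDle hT0.le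
    rw [e1] at this
    linarith
  have htail : Dl / Dl ^ j * K ^ 4 ≤ 16 * E₁ := by
    have e1 : Dl / Dl ^ j = T ^ (η - η * j) := by
      rw [hDl, ← Real.rpow_natCast, ← Real.rpow_mul hT0.le, ← Real.rpow_sub hT0]
    have h3 : T ^ (η - η * j) ≤ T ^ (-(4 : ℝ)) := hTle (by linarith)
    have h4 : K ^ 4 ≤ 16 * T ^ (4 : ℝ) := by
      calc K ^ 4 ≤ (2 * T) ^ 4 := pow_le_pow_left₀ hK0 hKT 4
        _ = 16 * T ^ (4 : ℝ) := by
            rw [mul_pow, show T ^ 4 = T ^ (4 : ℝ) by norm_cast]; norm_num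
    have h5 : T ^ (-(4 : ℝ)) * T ^ (4 : ℝ) = 1 := by rw [hTp]; norm_num
    calc Dl / Dl ^ j * K ^ 4 ≤ T ^ (-(4 : ℝ)) * (16 * T ^ (4 : ℝ)) := by
          rw [e1]; exact mul_le_mul h3 h4 (by positivity) (by positivity)
      _ = 16 * (T ^ (-(4 : ℝ)) * T ^ (4 : ℝ)) := by ring
      _ = 16 := by rw [h5, mul_one]
      _ ≤ 16 * E₁ := by linarith
  have hroot : (Dl * E₁ + Dl / Dl ^ j * K ^ 4) ^ (1 / 2 : ℝ) ≤ 5 * T ^ η * E₁ ^ (1 / 2 : ℝ) := by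
    have h2 : Dl * E₁ + Dl / Dl ^ j * K ^ 4 ≤ 25 * (T ^ η) ^ 2 * E₁ := by
      have h6 : T ^ η ≤ (T ^ η) ^ 2 := by
        have : 1 ≤ T ^ η := hDl1
        nlinarith
      have h8 : Dl * E₁ ≤ (T ^ η) ^ 2 * E₁ := mul_le_mul_of_nonneg_right h6 hE₁0
      have h9 : 16 * E₁ ≤ 16 * (T ^ η) ^ 2 * E₁ := by
        have h7 : (1 : ℝ) ≤ (T ^ η) ^ 2 := le_trans hDl1 h6
        nlinarith
      linarith
    calc (Dl * E₁ + Dl / Dl ^ j * K ^ 4) ^ (1 / 2 : ℝ) ≤ (25 * (T ^ η) ^ 2 * E₁) ^ (1 / 2 : ℝ) :=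
          Real.rpow_le_rpow (by positivity) h2 (by norm_num)
      _ = ((5 * T ^ η) ^ 2) ^ (1 / 2 : ℝ) * E₁ ^ (1 / 2 : ℝ) := by
          rw [← Real.mul_rpow (by positivity) hE₁0]; ring_nf
      _ = 5 * T ^ η * E₁ ^ (1 / 2 : ℝ) := by
          rw [← Real.sqrt_eq_rpow ((5 * T ^ η) ^ 2), Real.sqrt_sq (by positivity)]
  have hterm2 : C₁ * D * (N : ℝ) ^ 2 * K ^ 3 / T ^ 3 ≤ 2 * C₁ * ((N : ℝ) * K ^ 3) := by
    rw [div_le_iff₀ (by positivity)]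
    -- `D N² ≤ 2N⁴/T ≤ 2N⁴ ≤ 2 N T³`
    have hN3 : (N : ℝ) ^ 3 ≤ T ^ 3 := pow_le_pow_left₀ hn0.le hNT 3
    have h2 : (D : ℝ) * (N : ℝ) ^ 2 ≤ 2 * ((N : ℝ) * T ^ 3) := by
      have h3 : (N : ℝ) ^ 2 / T ≤ (N : ℝ) ^ 2 := div_le_self (by positivity) hT
      calc (D : ℝ) * (N : ℝ) ^ 2 ≤ 2 * ((N : ℝ) ^ 2 / T) * (N : ℝ) ^ 2 :=
            mul_le_mul_of_nonneg_right hDle' (by positivity)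
        _ ≤ 2 * (N : ℝ) ^ 2 * (N : ℝ) ^ 2 := by gcongr
        _ = 2 * ((N : ℝ) * (N : ℝ) ^ 3) := by ring
        _ ≤ 2 * ((N : ℝ) * T ^ 3) := by gcongr
    calc C₁ * D * (N : ℝ) ^ 2 * K ^ 3 = C₁ * K ^ 3 * ((D : ℝ) * (N : ℝ) ^ 2) := by ring
      _ ≤ C₁ * K ^ 3 * (2 * ((N : ℝ) * T ^ 3)) := mul_le_mul_of_nonneg_left h2 (by positivity)
      _ = 2 * C₁ * ((N : ℝ) * K ^ 3) * T ^ 3 := by ring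
  have hterm1 : C₁ * ((D : ℝ) * T + (N : ℝ) ^ 2) * K ^ (1 / 2 : ℝ) * (Dl * E₁ + Dl / Dl ^ j * K ^ 4) ^ (1 / 2 : ℝ)
      ≤ 15 * C₁ * T ^ η * ((N : ℝ) ^ 2 * K ^ (1 / 2 : ℝ) * E₁ ^ (1 / 2 : ℝ)) := by
    calc C₁ * ((D : ℝ) * T + (N : ℝ) ^ 2) * K ^ (1 / 2 : ℝ) * (Dl * E₁ + Dl / Dl ^ j * K ^ 4) ^ (1 / 2 : ℝ)
        ≤ C₁ * (3 * (N : ℝ) ^ 2) * K ^ (1 / 2 : ℝ) * (5 * T ^ η * E₁ ^ (1 / 2 : ℝ)) := by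
          gcongr
      _ = 15 * C₁ * T ^ η * ((N : ℝ) ^ 2 * K ^ (1 / 2 : ℝ) * E₁ ^ (1 / 2 : ℝ)) := by ring
  have hterm2' : 2 * C₁ * ((N : ℝ) * K ^ 3) ≤ 15 * C₁ * ((N : ℝ) * K ^ 3) := by
    have : 0 ≤ C₁ * ((N : ℝ) * K ^ 3) := by positivity
    linarith
  linarith [h1, hterm1, hterm2, hterm2']

set_option maxHeartbeats 1600000 in
/-- **The large-gcd part of `∑|R|³`, `T` free** (Lemma 11.9 of the paper, `D = ⌈N²/T⌉`,
`T^{3/4} ≤ N ≤ T`): for `0 < η ≤ 1` there is `C` with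
`∑_{D<d≤2N} ∑_{gcd=d} |R|³ ≤ C T^{2η} (5N|W|³ + 2|W|^{21/8}T^{1/4}N + 4N²|W|^{1/2}E(W)^{1/2})` for
`N ≥ 1`, `T ≥ 1` with `T^{3/4} ≤ N ≤ T` and finite non-empty `1`-separated `W` in an interval of
length `T` (`GuthMaynardEnergyBound.large_gcd_third_moment`, `N²/D ≤ T`, `1 + log 2N ≪ N^η ≤ T^η`,
`large_gcd_algebra`). [cite: GuthMaynard2026, Lemma 11.9 (arXiv v2 pp. 44–45)] -/
theorem large_part {η : ℝ} (hη : 0 < η) (hη1 : η ≤ 1) :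
    ∃ C, 0 ≤ C ∧ ∀ (N : ℕ), 1 ≤ N → ∀ (T t₀ : ℝ), 1 ≤ T → T ^ (3 / 4 : ℝ) ≤ (N : ℝ) → (N : ℝ) ≤ T →
      ∀ (W : Finset ℝ), (∀ t ∈ W, t₀ ≤ t ∧ t ≤ t₀ + T) →
      (∀ t ∈ W, ∀ t' ∈ W, t ≠ t' → 1 ≤ |t - t'|) → 1 ≤ W.card →
      ∑ d ∈ Finset.Ioc ⌈(N : ℝ) ^ 2 / T⌉₊ (2 * N), ∑ p ∈ gcdPairs N d, ‖Rfun W ((p.1 : ℝ) / p.2)‖ ^ 3 ≤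
        C * T ^ (2 * η) * (5 * ((N : ℝ) * (W.card : ℝ) ^ 3) +
          2 * ((W.card : ℝ) ^ (21 / 8 : ℝ) * T ^ (1 / 4 : ℝ) * (N : ℝ)) +
          4 * ((N : ℝ) ^ 2 * (W.card : ℝ) ^ (1 / 2 : ℝ) * ((((W ×ˢ W) ×ˢ (W ×ˢ W)).filter
            (fun q : (ℝ × ℝ) × (ℝ × ℝ) ↦ |q.1.1 + q.1.2 - q.2.1 - q.2.2| ≤ 1)).card : ℝ) ^ (1 / 2 : ℝ))) := by
  obtain ⟨C₅, hC₅0, hC₅⟩ := large_gcd_third_moment hη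
  set Cl : ℝ := 1 + 2 / η with hCl
  have hCl0 : 0 ≤ Cl := by positivity
  refine ⟨C₅ * Cl, by positivity, fun N hN T t₀ hT hN34 hNT W hW hsep hWpos ↦ ?_⟩
  have hn1 : (1 : ℝ) ≤ N := by exact_mod_cast hN
  have hn0 : (0 : ℝ) < N := by linarith
  have hT0 : 0 < T := by linarith
  have hTle : ∀ {x y : ℝ}, x ≤ y → T ^ x ≤ T ^ y :=
    fun h ↦ Real.rpow_le_rpow_of_exponent_le hT h
  have hTp : ∀ x y : ℝ, T ^ x * T ^ y = T ^ (x + y) := fun x y ↦ (Real.rpow_add hT0 x y).symm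
  set K : ℝ := (W.card : ℝ) with hK
  have hK0 : 0 ≤ K := Nat.cast_nonneg _
  have hK1 : 1 ≤ K := by rw [hK]; exact_mod_cast hWpos
  set E₁ : ℝ := ((((W ×ˢ W) ×ˢ (W ×ˢ W)).filter
    (fun q : (ℝ × ℝ) × (ℝ × ℝ) ↦ |q.1.1 + q.1.2 - q.2.1 - q.2.2| ≤ 1)).card : ℝ) with hE₁
  have hE₁0 : 0 ≤ E₁ := Nat.cast_nonneg _
  have hKE : K ^ 2 ≤ E₁ := card_sq_le_energy W
  have hE3 : E₁ ≤ 3 * K ^ 3 := energy_le_three_mul_card_cube W hsep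
  -- `T ≤ T^{3/2} = (T^{3/4})² ≤ N²`
  have hTN2 : T ≤ (N : ℝ) ^ 2 := by
    calc T = T ^ (1 : ℝ) := (Real.rpow_one T).symm
      _ ≤ T ^ ((3 / 4 : ℝ) * (2 : ℕ)) := hTle (by norm_num)
      _ = (T ^ (3 / 4 : ℝ)) ^ 2 := by rw [Real.rpow_mul hT0.le, Real.rpow_natCast]
      _ ≤ (N : ℝ) ^ 2 := pow_le_pow_left₀ (by positivity) hN34 2
  -- `D = ⌈N²/T⌉`
  set D : ℕ := ⌈(N : ℝ) ^ 2 / T⌉₊ with hD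
  have hq1 : 1 ≤ (N : ℝ) ^ 2 / T := by rw [le_div_iff₀ hT0, one_mul]; exact hTN2
  have hD1 : 1 ≤ D := Nat.ceil_pos.mpr (by linarith)
  have hDr0 : (0 : ℝ) < D := by exact_mod_cast hD1
  have hDge : (N : ℝ) ^ 2 / T ≤ D := Nat.le_ceil _
  -- Lemma 11.9 (before the case analysis)
  set A : ℝ := K ^ 2 * N + K * (N : ℝ) ^ 2 / D + K ^ (5 / 4 : ℝ) * T ^ (1 / 2 : ℝ) * N with hA
  set B : ℝ := K ^ 4 * N + (N : ℝ) ^ 2 / D * E₁ + E₁ ^ (3 / 4 : ℝ) * K * T ^ (1 / 2 : ℝ) * N with hB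
  have hA0 : 0 ≤ A := by positivity
  have hB0 : 0 ≤ B := by positivity
  have h1 : ∑ d ∈ Finset.Ioc D (2 * N), ∑ p ∈ gcdPairs N d, ‖Rfun W ((p.1 : ℝ) / p.2)‖ ^ 3 ≤
      C₅ * T ^ η * (1 + Real.log ((2 * N : ℕ) : ℝ)) * A ^ (1 / 2 : ℝ) * B ^ (1 / 2 : ℝ) :=
    hC₅ N D hN hD1 T t₀ hT W hW hsep
  -- `A ≤ A₀`, `B ≤ B₀`
  set A₀ : ℝ := K ^ 2 * N + K * T + K ^ (5 / 4 : ℝ) * T ^ (1 / 2 : ℝ) * N with hA₀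
  set B₀ : ℝ := K ^ 4 * N + T * E₁ + E₁ ^ (3 / 4 : ℝ) * K * T ^ (1 / 2 : ℝ) * N with hB₀
  have hn2D : (N : ℝ) ^ 2 / D ≤ T := by
    rw [div_le_iff₀ hDr0]
    have := (div_le_iff₀ hT0).mp hDge
    linarith
  have hAA₀ : A ≤ A₀ := by
    have h2 : K * (N : ℝ) ^ 2 / D ≤ K * T := by
      rw [mul_div_assoc]; exact mul_le_mul_of_nonneg_left hn2D hK0
    rw [hA, hA₀]; linarith
  have hBB₀ : B ≤ B₀ := by
    have h2 : (N : ℝ) ^ 2 / D * E₁ ≤ T * E₁ := mul_le_mul_of_nonneg_right hn2D hE₁0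
    rw [hB, hB₀]; linarith
  have halg : A₀ ^ (1 / 2 : ℝ) * B₀ ^ (1 / 2 : ℝ) ≤ 5 * K ^ 3 * N + 2 * K ^ (21 / 8 : ℝ) * T ^ (1 / 4 : ℝ) * N +
      4 * E₁ ^ (1 / 2 : ℝ) * K ^ (1 / 2 : ℝ) * (N : ℝ) ^ 2 := large_gcd_algebra hT hN34 hK1 hKE hE3
  have hAB : A ^ (1 / 2 : ℝ) * B ^ (1 / 2 : ℝ) ≤ 5 * K ^ 3 * N + 2 * K ^ (21 / 8 : ℝ) * T ^ (1 / 4 : ℝ) * N +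
      4 * E₁ ^ (1 / 2 : ℝ) * K ^ (1 / 2 : ℝ) * (N : ℝ) ^ 2 := by
    refine le_trans ?_ halg
    exact mul_le_mul (Real.rpow_le_rpow hA0 hAA₀ (by norm_num)) (Real.rpow_le_rpow hB0 hBB₀ (by norm_num))
      (Real.rpow_nonneg hB0 _) (Real.rpow_nonneg (hA0.trans hAA₀) _)
  -- `T^η (1 + log 2N) ≤ Cl T^{2η}`
  have hL : 1 + Real.log ((2 * N : ℕ) : ℝ) ≤ Cl * T ^ η := by
    have e : ((2 * N : ℕ) : ℝ) = 2 * (N : ℝ) := by push_cast; ring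
    rw [e]
    calc 1 + Real.log (2 * (N : ℝ)) ≤ Cl * (N : ℝ) ^ η := one_add_log_le hη hη1 hn1
      _ ≤ Cl * T ^ η := by
          gcongr
  have hL0 : 0 ≤ 1 + Real.log ((2 * N : ℕ) : ℝ) := by
    have : 0 ≤ Real.log ((2 * N : ℕ) : ℝ) :=
      Real.log_nonneg (by exact_mod_cast (show 1 ≤ 2 * N by omega))
    linarith
  have hTL : T ^ η * (1 + Real.log ((2 * N : ℕ) : ℝ)) ≤ Cl * T ^ (2 * η) := by
    calc T ^ η * (1 + Real.log ((2 * N : ℕ) : ℝ)) ≤ T ^ η * (Cl * T ^ η) :=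
          mul_le_mul_of_nonneg_left hL (by positivity)
      _ = Cl * (T ^ η * T ^ η) := by ring
      _ = Cl * T ^ (2 * η) := by rw [hTp]; ring_nf
  have hfin0 : 0 ≤ 5 * K ^ 3 * N + 2 * K ^ (21 / 8 : ℝ) * T ^ (1 / 4 : ℝ) * N +
      4 * E₁ ^ (1 / 2 : ℝ) * K ^ (1 / 2 : ℝ) * (N : ℝ) ^ 2 := by positivity
  calc ∑ d ∈ Finset.Ioc D (2 * N), ∑ p ∈ gcdPairs N d, ‖Rfun W ((p.1 : ℝ) / p.2)‖ ^ 3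
      ≤ C₅ * T ^ η * (1 + Real.log ((2 * N : ℕ) : ℝ)) * A ^ (1 / 2 : ℝ) * B ^ (1 / 2 : ℝ) := h1
    _ = C₅ * (T ^ η * (1 + Real.log ((2 * N : ℕ) : ℝ))) * (A ^ (1 / 2 : ℝ) * B ^ (1 / 2 : ℝ)) := by ring
    _ ≤ C₅ * (Cl * T ^ (2 * η)) * (5 * K ^ 3 * N + 2 * K ^ (21 / 8 : ℝ) * T ^ (1 / 4 : ℝ) * N +
        4 * E₁ ^ (1 / 2 : ℝ) * K ^ (1 / 2 : ℝ) * (N : ℝ) ^ 2) :=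
        mul_le_mul (mul_le_mul_of_nonneg_left hTL hC₅0) hAB (by positivity) (by positivity)
    _ = _ := by ring

/-! ## §4. The rearrangement and the proof of Proposition 11.1 -/

set_option maxHeartbeats 1600000 in
/-- **The final algebra of §11, `T` free**: if `E ≤ C₀ n^{-2σ} S` and
`S ≤ C₆ T^{2η} (n²K^{1/2}E^{1/2} + nK³ + K^{21/8}T^{1/4}n)` with `4η ≤ ε`, `n, T ≥ 1`, then
`E ≤ (2C₀C₆ + (C₀C₆)²) T^ε (K n^{4−4σ} + K^{21/8}T^{1/4}n^{1−2σ} + K³n^{1−2σ})`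
("This rearranges to give …", via `E ≤ X + YE^{1/2} ⇒ E ≤ 2X + Y²`).
[cite: GuthMaynard2026, proof of Proposition 11.1 (arXiv v2 p. 45)] -/
theorem final_algebra {n T K E S C₀ C₆ σ η ε : ℝ} (hn : 1 ≤ n) (hT : 1 ≤ T) (hK : 0 ≤ K) (hE : 0 ≤ E)
    (hC₀ : 0 ≤ C₀) (hC₆ : 0 ≤ C₆) (hη : 0 ≤ η) (hηε : 4 * η ≤ ε)
    (h1 : E ≤ C₀ * n ^ (-2 * σ) * S)
    (h2 : S ≤ C₆ * T ^ (2 * η) * (n ^ 2 * K ^ (1 / 2 : ℝ) * E ^ (1 / 2 : ℝ) + n * K ^ 3 +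
      K ^ (21 / 8 : ℝ) * T ^ (1 / 4 : ℝ) * n)) :
    E ≤ (2 * (C₀ * C₆) + (C₀ * C₆) ^ 2) * T ^ ε * (K * n ^ (4 - 4 * σ) +
      K ^ (21 / 8 : ℝ) * T ^ (1 / 4 : ℝ) * n ^ (1 - 2 * σ) + K ^ 3 * n ^ (1 - 2 * σ)) := by
  have hn0 : 0 < n := by linarith
  have hT0 : 0 < T := by linarith
  have hTle : ∀ {x y : ℝ}, x ≤ y → T ^ x ≤ T ^ y := fun h ↦ Real.rpow_le_rpow_of_exponent_le hT h
  have hTp : ∀ x y : ℝ, T ^ x * T ^ y = T ^ (x + y) := fun x y ↦ (Real.rpow_add hT0 x y).symm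
  have hnp : ∀ x y : ℝ, n ^ x * n ^ y = n ^ (x + y) := fun x y ↦ (Real.rpow_add hn0 x y).symm
  have hσpow : n ^ (-2 * σ) * n ^ 2 = n ^ (2 - 2 * σ) := by
    rw [show n ^ 2 = n ^ (2 : ℝ) by norm_cast, hnp]; ring_nf
  have hσpow1 : n ^ (-2 * σ) * n = n ^ (1 - 2 * σ) := by
    rw [show n ^ (-2 * σ) * n = n ^ (-2 * σ) * n ^ (1 : ℝ) by rw [Real.rpow_one], hnp]; ring_nf
  set Y : ℝ := C₀ * C₆ * T ^ (2 * η) * n ^ (2 - 2 * σ) * K ^ (1 / 2 : ℝ) with hY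
  set X : ℝ := C₀ * C₆ * T ^ (2 * η) * (K ^ 3 * n ^ (1 - 2 * σ) +
    K ^ (21 / 8 : ℝ) * T ^ (1 / 4 : ℝ) * n ^ (1 - 2 * σ)) with hX
  have hEXY : E ≤ X + Y * E ^ (1 / 2 : ℝ) := by
    calc E ≤ C₀ * n ^ (-2 * σ) * S := h1
      _ ≤ C₀ * n ^ (-2 * σ) * (C₆ * T ^ (2 * η) * (n ^ 2 * K ^ (1 / 2 : ℝ) * E ^ (1 / 2 : ℝ) + n * K ^ 3 +
          K ^ (21 / 8 : ℝ) * T ^ (1 / 4 : ℝ) * n)) := mul_le_mul_of_nonneg_left h2 (by positivity)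
      _ = X + Y * E ^ (1 / 2 : ℝ) := by
          rw [hX, hY]
          linear_combination (C₀ * C₆ * T ^ (2 * η) * K ^ (1 / 2 : ℝ) * E ^ (1 / 2 : ℝ)) * hσpow +
            (C₀ * C₆ * T ^ (2 * η) * K ^ 3) * hσpow1 +
            (C₀ * C₆ * T ^ (2 * η) * K ^ (21 / 8 : ℝ) * T ^ (1 / 4 : ℝ)) * hσpow1
  have hEfin : E ≤ 2 * X + Y ^ 2 := le_of_sqrt_bound hE hEXY
  have hTε1 : T ^ (2 * η) ≤ T ^ ε := hTle (by linarith)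
  have hTε2 : T ^ (2 * η) * T ^ (2 * η) ≤ T ^ ε := by rw [hTp]; exact hTle (by linarith)
  have hY2 : Y ^ 2 = (C₀ * C₆) ^ 2 * (T ^ (2 * η) * T ^ (2 * η)) * (K * n ^ (4 - 4 * σ)) := by
    have e1 : (n ^ (2 - 2 * σ)) ^ 2 = n ^ (4 - 4 * σ) := by
      rw [← Real.rpow_natCast, ← Real.rpow_mul hn0.le]; ring_nf
    have e2 : (K ^ (1 / 2 : ℝ)) ^ 2 = K := by
      rw [← Real.rpow_natCast, ← Real.rpow_mul hK]; norm_num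
    rw [hY, mul_pow, mul_pow, mul_pow, mul_pow, e1, e2]; ring
  set V : ℝ := K * n ^ (4 - 4 * σ) with hV
  set Z : ℝ := K ^ (21 / 8 : ℝ) * T ^ (1 / 4 : ℝ) * n ^ (1 - 2 * σ) + K ^ 3 * n ^ (1 - 2 * σ) with hZ
  have hV0 : 0 ≤ V := by positivity
  have hZ0 : 0 ≤ Z := by positivity
  have hXZ : X = C₀ * C₆ * T ^ (2 * η) * Z := by rw [hX, hZ]; ring
  have h2X : 2 * X ≤ 2 * (C₀ * C₆) * T ^ ε * Z := by
    have : C₀ * C₆ * T ^ (2 * η) * Z ≤ C₀ * C₆ * T ^ ε * Z := by gcongr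
    rw [hXZ]; linarith
  have hY2le : Y ^ 2 ≤ (C₀ * C₆) ^ 2 * T ^ ε * V := by
    rw [hY2]; gcongr
  have hc1 : 0 ≤ 2 * (C₀ * C₆) * T ^ ε := by positivity
  have hc2 : 0 ≤ (C₀ * C₆) ^ 2 * T ^ ε := by positivity
  calc E ≤ 2 * X + Y ^ 2 := hEfin
    _ ≤ 2 * (C₀ * C₆) * T ^ ε * Z + (C₀ * C₆) ^ 2 * T ^ ε * V := add_le_add h2X hY2le
    _ ≤ 2 * (C₀ * C₆) * T ^ ε * (V + Z) + (C₀ * C₆) ^ 2 * T ^ ε * (V + Z) := by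
        nlinarith [mul_nonneg hc1 hV0, mul_nonneg hc2 hZ0]
    _ = _ := by rw [hV, hZ]; ring

end GuthMaynardEnergyAsPrinted

set_option maxHeartbeats 1600000 in
/-- **Guth–Maynard Proposition 11.1 as printed, proved** (discharge of
`GuthMaynard2026_proposition_11_1`), following the printed proof with `T` free: Lemma 11.4
(`energy_le_third_moment_abs`, applied to `b` extended by `b_N := 0`); split `∑_{n₁,n₂}|R(n₁/n₂)|³` at
`gcd = D = ⌈N²/T⌉`; Lemma 11.8 for `gcd ≤ D` (`GuthMaynardEnergyAsPrinted.small_part`) and Lemma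
11.9 with its case analysis for `gcd > D` (`GuthMaynardEnergyAsPrinted.large_part`); rearrange
(`GuthMaynardEnergyAsPrinted.final_algebra`). The `⪅`-losses are `T^η` from `Dl = T^η` in Lemma
11.8 and `T^{2η}` from Heath-Brown's `T^η` and `1 + log 2N ≪ T^η` in Lemma 11.9, `η = min(ε,1)/8`.
[cite: GuthMaynard2026, Proposition 11.1 (arXiv v2 p. 38; proof p. 45)] -/
theorem GuthMaynard2026_proposition_11_1_holds : GuthMaynard2026_proposition_11_1 := by
  intro ε hε
  -- `η = min(ε,1)/8`
  set m : ℝ := min ε 1 with hm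
  have hm0 : 0 < m := lt_min hε one_pos
  have hm1 : m ≤ 1 := min_le_right _ _
  have hmε : m ≤ ε := min_le_left _ _
  set η : ℝ := m / 8 with hη
  have hη0 : 0 < η := by positivity
  have hη1 : η ≤ 1 := by rw [hη]; linarith
  have hηε : 4 * η ≤ ε := by rw [hη]; linarith
  obtain ⟨C₀, hC₀0, hC₀⟩ := energy_le_third_moment_abs
  obtain ⟨Cs, hCs0, hCs⟩ := GuthMaynardEnergyAsPrinted.small_part hη0
  obtain ⟨Cg, hCg0, hCg⟩ := GuthMaynardEnergyAsPrinted.large_part hη0 hη1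
  set C₆ : ℝ := Cs + 5 * Cg with hC₆
  have hC₆0 : 0 ≤ C₆ := by positivity
  refine ⟨2 * (C₀ * C₆) + (C₀ * C₆) ^ 2, 1, fun T hT N hN34 hNT σ b t₀ W hb hW hsep hlarge ↦ ?_⟩
  classical
  have hT0 : 0 < T := by linarith
  have hn1 : (1 : ℝ) ≤ N := (Real.one_le_rpow hT (by norm_num : (0 : ℝ) ≤ 3 / 4)).trans hN34
  have hN1 : 1 ≤ N := by exact_mod_cast hn1
  have hn0 : (0 : ℝ) < N := by linarith
  have hTN2 : T ≤ (N : ℝ) ^ 2 := by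
    calc T = T ^ (1 : ℝ) := (Real.rpow_one T).symm
      _ ≤ T ^ ((3 / 4 : ℝ) * (2 : ℕ)) := Real.rpow_le_rpow_of_exponent_le hT (by norm_num)
      _ = (T ^ (3 / 4 : ℝ)) ^ 2 := by rw [Real.rpow_mul hT0.le, Real.rpow_natCast]
      _ ≤ (N : ℝ) ^ 2 := pow_le_pow_left₀ (by positivity) hN34 2
  set K : ℝ := (W.card : ℝ) with hK
  have hK0 : 0 ≤ K := Nat.cast_nonneg _
  set E₁ : ℝ := ((((W ×ˢ W) ×ˢ (W ×ˢ W)).filter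
    (fun q : (ℝ × ℝ) × (ℝ × ℝ) ↦ |q.1.1 + q.1.2 - q.2.1 - q.2.2| ≤ 1)).card : ℝ) with hE₁
  have hE₁0 : 0 ≤ E₁ := Nat.cast_nonneg _
  have hEdef : GuthMaynardAssembly.addEnergy W = E₁ := rfl
  rw [hEdef]
  have hRHS0 : 0 ≤ (2 * (C₀ * C₆) + (C₀ * C₆) ^ 2) * T ^ ε * (K * (N : ℝ) ^ (4 - 4 * σ) +
      K ^ (21 / 8 : ℝ) * T ^ (1 / 4 : ℝ) * (N : ℝ) ^ (1 - 2 * σ) + K ^ 3 * (N : ℝ) ^ (1 - 2 * σ)) := by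
    positivity
  -- the empty case
  rcases Nat.eq_zero_or_pos W.card with hW0 | hWpos
  · have hE3 : E₁ ≤ 3 * K ^ 3 := energy_le_three_mul_card_cube W hsep
    have hK00 : K = 0 := by rw [hK, hW0, Nat.cast_zero]
    rw [hK00] at hE3
    linarith
  have hWpos' : 1 ≤ W.card := hWpos
  -- the printed half-open sum `∑_{N<n≤2N}` is the tree's closed sum for `b` extended by `b_N = 0`
  set b' : ℕ → ℂ := fun n ↦ if n = N then 0 else b n with hb'
  have hb'1 : ∀ n, ‖b' n‖ ≤ 1 := fun n ↦ by
    simp only [hb']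
    split_ifs
    · simp
    · exact hb n
  have hsum : ∀ t : ℝ, ∑ n ∈ Finset.Icc N (2 * N), b' n * (n : ℂ) ^ ((t : ℂ) * I) =
      ∑ n ∈ Finset.Ioc N (2 * N), b n * (n : ℂ) ^ ((t : ℂ) * I) := by
    intro t
    have hIcc : Finset.Icc N (2 * N) = insert N (Finset.Ioc N (2 * N)) := by
      ext n
      simp only [Finset.mem_Icc, Finset.mem_insert, Finset.mem_Ioc]
      omega
    rw [hIcc, Finset.sum_insert (by simp)]
    simp only [hb', if_pos rfl, zero_mul, zero_add]
    refine Finset.sum_congr rfl fun n hn ↦ ?_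
    rw [Finset.mem_Ioc] at hn
    rw [if_neg (by omega)]
  have hlarge' : ∀ t ∈ W, (N : ℝ) ^ σ ≤
      ‖∑ n ∈ Finset.Icc N (2 * N), b' n * (n : ℂ) ^ ((t : ℂ) * I)‖ :=
    fun t ht ↦ by rw [hsum]; exact hlarge t ht
  -- Step 1: Lemma 11.4
  set S₃ : ℝ := ∑ n₁ ∈ Finset.Icc N (2 * N), ∑ n₂ ∈ Finset.Icc N (2 * N),
    ‖Rfun W ((n₁ : ℝ) / n₂)‖ ^ 3 with hS₃
  have h114 : E₁ ≤ C₀ * (N : ℝ) ^ (-2 * σ) * S₃ := hC₀ N hN1 σ b' W hb'1 hsep hlarge'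
  -- Step 2: split at `D = ⌈N²/T⌉`
  set D : ℕ := ⌈(N : ℝ) ^ 2 / T⌉₊ with hD
  set f : ℕ → ℝ := fun d ↦ ∑ p ∈ gcdPairs N d, ‖Rfun W ((p.1 : ℝ) / p.2)‖ ^ 3 with hf
  have hf0 : ∀ d, 0 ≤ f d := fun d ↦ by positivity
  have hsplit : S₃ ≤ ∑ d ∈ Finset.Icc 1 D, f d + ∑ d ∈ Finset.Ioc D (2 * N), f d := by
    have e : S₃ = ∑ d ∈ Finset.Icc 1 (2 * N), f d :=
      sum_sq_eq_sum_gcd hN1 (fun n₁ n₂ ↦ ‖Rfun W ((n₁ : ℝ) / n₂)‖ ^ 3)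
    have hsub : Finset.Icc 1 (2 * N) ⊆ Finset.Icc 1 D ∪ Finset.Ioc D (2 * N) := by
      intro d hd
      rw [Finset.mem_Icc] at hd
      rw [Finset.mem_union, Finset.mem_Icc, Finset.mem_Ioc]
      omega
    have hdisj : Disjoint (Finset.Icc 1 D) (Finset.Ioc D (2 * N)) := by
      rw [Finset.disjoint_left]
      intro d hd hd'
      rw [Finset.mem_Icc] at hd
      rw [Finset.mem_Ioc] at hd'
      omega
    rw [e]
    calc ∑ d ∈ Finset.Icc 1 (2 * N), f d ≤ ∑ d ∈ Finset.Icc 1 D ∪ Finset.Ioc D (2 * N), f d :=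
          Finset.sum_le_sum_of_subset_of_nonneg hsub fun d _ _ ↦ hf0 d
      _ = _ := Finset.sum_union hdisj
  -- Step 3: the two parts
  have hS := hCs N hN1 T t₀ hT hNT hTN2 W hW hsep hWpos'
  have hL := hCg N hN1 T t₀ hT hN34 hNT W hW hsep hWpos'
  set P : ℝ := (N : ℝ) ^ 2 * K ^ (1 / 2 : ℝ) * E₁ ^ (1 / 2 : ℝ) with hP
  set Q : ℝ := (N : ℝ) * K ^ 3 with hQ
  set U : ℝ := K ^ (21 / 8 : ℝ) * T ^ (1 / 4 : ℝ) * (N : ℝ) with hU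
  change ∑ d ∈ Finset.Icc 1 D, f d ≤ Cs * T ^ η * P + Cs * Q at hS
  change ∑ d ∈ Finset.Ioc D (2 * N), f d ≤ Cg * T ^ (2 * η) * (5 * Q + 2 * U + 4 * P) at hL
  have hP0 : 0 ≤ P := by positivity
  have hQ0 : 0 ≤ Q := by positivity
  have hU0 : 0 ≤ U := by positivity
  have hT2η1 : 1 ≤ T ^ (2 * η) := Real.one_le_rpow hT (by positivity)
  have hTη2η : T ^ η ≤ T ^ (2 * η) := Real.rpow_le_rpow_of_exponent_le hT (by linarith)
  have hS₃le : S₃ ≤ C₆ * T ^ (2 * η) * (P + Q + U) := by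
    have h2 : Cs * T ^ η * P ≤ Cs * T ^ (2 * η) * P := by gcongr
    have h3 : Cs * Q ≤ Cs * T ^ (2 * η) * Q := by
      have : Cs * Q * 1 ≤ Cs * Q * T ^ (2 * η) := mul_le_mul_of_nonneg_left hT2η1 (by positivity)
      linarith
    have h4 : Cg * T ^ (2 * η) * (5 * Q + 2 * U + 4 * P) ≤ 5 * Cg * T ^ (2 * η) * (P + Q + U) := by
      have : 0 ≤ Cg * T ^ (2 * η) := by positivity
      nlinarith
    have h5 : Cs * T ^ (2 * η) * P + Cs * T ^ (2 * η) * Q ≤ Cs * T ^ (2 * η) * (P + Q + U) := by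
      have : 0 ≤ Cs * T ^ (2 * η) := by positivity
      nlinarith
    calc S₃ ≤ Cs * T ^ η * P + Cs * Q + Cg * T ^ (2 * η) * (5 * Q + 2 * U + 4 * P) := by
          linarith
      _ ≤ Cs * T ^ (2 * η) * (P + Q + U) + 5 * Cg * T ^ (2 * η) * (P + Q + U) := by linarith
      _ = C₆ * T ^ (2 * η) * (P + Q + U) := by rw [hC₆]; ring
  -- Step 4: rearrange
  exact GuthMaynardEnergyAsPrinted.final_algebra hn1 hT hK0 hE₁0 hC₀0 hC₆0 hη0.le hηε h114 hS₃le

end Literature.NumberTheory.LFunctions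

end
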